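import Summits.HodgeConjecture.HodgeConjecture.Theorems.F0P3cStCharTSTorusCompactPart              -- ★ `mem_unitsIntegers_iff`; brings ★ `conjLocal_apply_eq_of_smul_eq`, ★ `PlacesOver.subsingleton_of_smul_eq`, ★ `LocalRing.eq_iff_apply_eq`
import Summits.HodgeConjecture.HodgeConjecture.Theorems.F0P3cStCharTSLocalRingNormDictionary        -- ★ `isUnit_iff_ne_zero_localRing`
import Literature.NumberTheory.LocalFields.LocalFieldInvolutionNormIndexTwo                          -- ★ `LocalFieldInvolutionNorm.norm_dichotomy_of_not_norm` (`[F^× : N E^×] ≤ 2`)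
import Literature.NumberTheory.Automorphic.AdicCompletionLocalField                                  -- ★ instances `ValuativeRel ∕ IsNonarchimedeanLocalField (w.adicCompletion L)`
import Literature.NumberTheory.Automorphic.UnitaryGroupRegularTwistModulus                           -- ★ `exists_conjLocal_skew_unit` (`σ ≠ id`)
import HarnessLib

/-!
# R90 · S1 ∕ U4Keys leaf — a character of `E_vˣ` that KILLS ALL NORMS `σ(y)·y` and is NON-TRIVIAL on some `σ`-fixed unit IS `ω_{E∕F}` on `F_v^×`
# (`IsQuadraticCharExtension`), at EVERY non-split place — from the local norm index `[F_v^× : N E_w^×] ≤ 2` [Serre, Corps locaux V §3, XIV §2; Rogawski1990 §4.8]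

Cell `hodgecm-mathlib`, SLAB R90-TF, section S1 «Ch. 12 local», crux H413 = `stmt-HodgeConjecture-24833` (lane `--supports … --as helper`), route
HCCMUnconditional; prover seat `hodgecm-mathlib-R90-C10-p05` (g0); socket of record S1#3′ `R90.S1.stub_R90_122_keysThmTwo_ramifiedCharOne` = K2E3 leaf
(U4f-χ₁-ram-one) ⊇ U4Keys :155 (depth 0, Branch B).  THEOREMS ONLY (no definition ∕ instance ∕ notation ∕ named fact ∕ `sorry`); ★-only imports.
Paper: `K2/R90-C10-p05/PAPER-Z3-DepthZeroRamified.R90-C10-p05-g0.md` §2 «CONVERSION» (r01 junk-screen SOUND, remark R-e).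

WHAT.  `R = LocalRing L v = Π_{w′∣v} L_{w′}` at a NON-SPLIT place `v` (one `w ∣ v`, `c • w = w`), `σ = conjLocal` (`= σ_w` on the factor, ★ `conjLocal_apply_eq_of_smul_eq`),
`η : Rˣ →* ℂˣ`.  **`isQuadraticCharExtension_of_forall_norm_of_exists_fixed`**: if `η(σ(y)·y) = 1` for EVERY unit `y` of `R` and `η(x₀) ≠ 1` for SOME `σ`-fixed unit `x₀`,
then ★ `IsQuadraticCharExtension σ η` («on `σ`-fixed units, `η x = 1 ↔ x` is a norm `σ(y)·y`», i.e. `η|_{F_v^×} = ω_{E_w∕F_v}`).  PROOF: `x₀` is a fixed NON-norm (a norm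
would be killed); by the local norm index theorem in its involution form (★ `LocalFieldInvolutionNorm.norm_dichotomy_of_not_norm` on the local field `L_w` with the
involution `σ_w`: every fixed `s ≠ 0` is `N z` or `x₀·s = N z`) a fixed `x` with `η x = 1` cannot lie in the class `x₀⁻¹·N` (else `η x₀ = 1`), so it is a norm; the
converse is the hypothesis.  The transport `R ↔ L_w` is ★ `LocalRing.eq_iff_apply_eq` plus the lift of a non-zero `z ∈ L_w` to a unit of `R` (one place).
WHY (consumer).  This is the place-parity-free form of the «CONVERSION» step Z5 of the depth-zero Branch-B leaf: at an INERT place ★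
`K2E3KeysThmTwoDepthZeroBranchBConversion` gets non-triviality from `η(ϖ) = −1`; at a RAMIFIED place (paper §2) `η := χ₁·‖·‖^{-1∕2}` kills the norms by `hB` + the root
`χ₁(NΠ) = ‖NΠ‖^{1∕2}` and is non-trivial on a fixed unit because `𝓀_v = 𝓀_w` — the sequel `R90S1KeysThmTwoDepthZeroBranchBConversionRamified` feeds exactly these two facts here.
HONEST LABEL: HC_CM is proved only modulo the 7 printed citations (2 remaining named inputs: hLiu418 = `stmt-HodgeConjecture-24832`, h413 = `stmt-HodgeConjecture-24833`)
until rung 0 closes; count-neutral helper (local class field theory for `[E : F] = 2`, made available in the `conjLocal` currency).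

## References
* [Serre1979] J.-P. Serre, *Local Fields*, GTM 67 (1979), Ch. V §2 Prop. 3 Cor., §3 Prop. 5 Cor. 3; Ch. XIV §2 (the local norm index for a quadratic extension).
* [NeukirchANT1999] J. Neukirch, *Algebraic Number Theory* (1999), Ch. V (1.3).
* [Rogawski1990] J. D. Rogawski, *Automorphic Representations of Unitary Groups in Three Variables*, Ann. of Math. Stud. 123 (1990), §4.8 p. 51 (`μ|_{F^×} = ω_{E∕F}`), §12.2 (2) p. 173.
-/

set_option autoImplicit false
-- the mandated namespace has the single-problem summit's repeated segment (`HodgeConjecture.HodgeConjecture`)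
set_option linter.dupNamespace false

noncomputable section

open NumberField IsDedekindDomain
open Literature.NumberTheory.Automorphic Literature.NumberTheory.Automorphic.UnitaryGroup
open Summit.HodgeConjecture.HodgeConjecture.Cruxes.H413

namespace Summit.HodgeConjecture.HodgeConjecture.R90.S1

variable (L : Type) [Field L] [NumberField L] [IsCMField L] (v : HeightOneSpectrum (𝓞 ↥(maximalRealSubfield L)))
  (w : PlacesOver L v) (hw : IsCMField.complexConj L • w.1 = w.1)

include hw in
/-- **Lift of a non-zero element of `L_w` to a unit of `E_v = Π_{w′∣v} L_{w′}`** (one place above the non-split `v`). [cite: CasselsFrohlichANT1967, Ch. II §10] -/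
private theorem exists_unit_apply_eq {z : w.1.adicCompletion L} (hz : z ≠ 0) :
    ∃ y : (LocalRing L v)ˣ, (y : LocalRing L v) w = z := by
  classical
  set y₀ : LocalRing L v := Function.update 0 w z with hy₀
  have hy₀w : y₀ w = z := by rw [hy₀, Function.update_self]
  have hne : y₀ ≠ 0 := fun h => hz (by rw [← hy₀w, h, Pi.zero_apply])
  have hu : IsUnit y₀ := (F0P3cStCharTSLocalRingNormDictionary.isUnit_iff_ne_zero_localRing L v w hw y₀).2 hne
  exact ⟨hu.unit, by rw [hu.unit_spec, hy₀w]⟩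

include hw in
/-- **A character of `E_vˣ` killing every norm `σ(y)·y` and non-trivial on some `σ`-fixed unit is `ω_{E∕F}` on `F_v^×`** (★ `IsQuadraticCharExtension σ η`), at every
non-split place `v`: `x₀` is a fixed non-norm, and by the local norm index theorem (★ `LocalFieldInvolutionNorm.norm_dichotomy_of_not_norm` on `L_w` with `σ_w`: each fixed
`s ≠ 0` is `z·σz` or `x₀·s = z·σz`) a fixed `x` with `η x = 1` is a norm — the other class would force `η x₀ = 1`.
[cite: Serre1979, Ch. V §3 Prop. 5 Cor. 3; Ch. XIV §2] [cite: NeukirchANT1999, Ch. V (1.3)] [cite: Rogawski1990, §4.8 p. 51] -/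
theorem isQuadraticCharExtension_of_forall_norm_of_exists_fixed (η : (LocalRing L v)ˣ →* ℂˣ)
    (hN : ∀ y : (LocalRing L v)ˣ, η (Units.map (conjLocal L (IsCMField.complexConj L) v : LocalRing L v →* LocalRing L v) y * y) = 1)
    (hx : ∃ x₀ : (LocalRing L v)ˣ, conjLocal L (IsCMField.complexConj L) v (x₀ : LocalRing L v) = x₀ ∧ η x₀ ≠ 1) :
    IsQuadraticCharExtension (conjLocal L (IsCMField.complexConj L) v) η := by
  classical
  haveI : Subsingleton (PlacesOver L v) :=
    PlacesOver.subsingleton_of_smul_eq (IsCMField.complexConj L) (IsCMField.complexConj_ne_one L) w hw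
  haveI : CharZero (w.1.adicCompletion L) := charZero_of_injective_algebraMap (algebraMap L (w.1.adicCompletion L)).injective
  obtain ⟨x₀, hx₀fix, hx₀⟩ := hx
  -- the local involution `σ_w` on the local field `L_w`, its square and non-triviality
  set σw : w.1.adicCompletion L →+* w.1.adicCompletion L := galAdicCompletionMap (L := L) (IsCMField.complexConj L) hw with hσw
  have hcomp : ∀ y : LocalRing L v, conjLocal L (IsCMField.complexConj L) v y w = σw (y w) :=
    fun y => conjLocal_apply_eq_of_smul_eq (IsCMField.complexConj L) (IsCMField.complexConj_ne_one L) v w hw y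
  have hσσ : ∀ z : w.1.adicCompletion L, σw (σw z) = z := by
    intro z
    by_cases hz : z = 0
    · rw [hz, map_zero, map_zero]
    obtain ⟨y, hy⟩ := exists_unit_apply_eq L v w hw hz
    have e := congrArg (fun t : LocalRing L v => t w) (conjLocal_conjLocal_cm L v (y : LocalRing L v))
    simp only [hcomp] at e
    rwa [hy] at e
  have hσ1 : σw ≠ RingHom.id (w.1.adicCompletion L) := by
    intro hid
    obtain ⟨δ, hδ⟩ := exists_conjLocal_skew_unit L v
    have e := congrArg (fun t : LocalRing L v => t w) hδ
    simp only [hcomp, hid, RingHom.id_apply, Pi.neg_apply] at e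
    have hδ0 : (δ : LocalRing L v) w ≠ 0 := fun h0 =>
      ((F0P3cStCharTSLocalRingNormDictionary.isUnit_iff_ne_zero_localRing L v w hw _).1 δ.isUnit)
        ((LocalRing.eq_iff_apply_eq (IsCMField.complexConj L) (IsCMField.complexConj_ne_one L) w hw _ 0).2 h0)
    exact hδ0 (by linear_combination e / 2)
  -- norms of units of `R` read at `w`
  have hnormw : ∀ y : (LocalRing L v)ˣ,
      ((Units.map (conjLocal L (IsCMField.complexConj L) v : LocalRing L v →* LocalRing L v) y * y : (LocalRing L v)ˣ) : LocalRing L v) w =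
        (y : LocalRing L v) w * σw ((y : LocalRing L v) w) := by
    intro y
    rw [Units.val_mul, Units.coe_map, MonoidHom.coe_coe, Pi.mul_apply, hcomp, mul_comm]
  -- a norm `z·σz = (x : R) w` with `x` a unit lifts to `σ(y)·y = x` in `Rˣ`
  have hlift : ∀ (x : (LocalRing L v)ˣ) (z : w.1.adicCompletion L), z * σw z = (x : LocalRing L v) w →
      ∃ y : (LocalRing L v)ˣ, Units.map (conjLocal L (IsCMField.complexConj L) v : LocalRing L v →* LocalRing L v) y * y = x := by
    intro x z hz
    have hz0 : z ≠ 0 := by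
      intro h0
      rw [h0, zero_mul] at hz
      exact ((F0P3cStCharTSLocalRingNormDictionary.isUnit_iff_ne_zero_localRing L v w hw _).1 x.isUnit)
        ((LocalRing.eq_iff_apply_eq (IsCMField.complexConj L) (IsCMField.complexConj_ne_one L) w hw _ 0).2 hz.symm)
    obtain ⟨y, hy⟩ := exists_unit_apply_eq L v w hw hz0
    refine ⟨y, Units.ext ((LocalRing.eq_iff_apply_eq (IsCMField.complexConj L) (IsCMField.complexConj_ne_one L) w hw _ _).2 ?_)⟩
    rw [hnormw, hy, hz]
  -- `x₀ w` is a fixed non-norm of `L_w`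
  have hx₀w : σw ((x₀ : LocalRing L v) w) = (x₀ : LocalRing L v) w := by rw [← hcomp, hx₀fix]
  have hx₀0 : (x₀ : LocalRing L v) w ≠ 0 := fun h0 =>
    ((F0P3cStCharTSLocalRingNormDictionary.isUnit_iff_ne_zero_localRing L v w hw _).1 x₀.isUnit)
      ((LocalRing.eq_iff_apply_eq (IsCMField.complexConj L) (IsCMField.complexConj_ne_one L) w hw _ 0).2 h0)
  have hx₀n : ∀ z : w.1.adicCompletion L, z * σw z ≠ (x₀ : LocalRing L v) w := by
    intro z hz
    obtain ⟨y, hy⟩ := hlift x₀ z hz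
    exact hx₀ (by rw [← hy]; exact hN y)
  -- the criterion
  intro x hxfix
  constructor
  · intro hηx
    have hxw : σw ((x : LocalRing L v) w) = (x : LocalRing L v) w := by rw [← hcomp, hxfix]
    have hx0' : (x : LocalRing L v) w ≠ 0 := fun h0 =>
      ((F0P3cStCharTSLocalRingNormDictionary.isUnit_iff_ne_zero_localRing L v w hw _).1 x.isUnit)
        ((LocalRing.eq_iff_apply_eq (IsCMField.complexConj L) (IsCMField.complexConj_ne_one L) w hw _ 0).2 h0)
    rcases Literature.NumberTheory.LocalFields.LocalFieldInvolutionNorm.norm_dichotomy_of_not_norm σw hσσ hσ1 hx₀w hx₀0 hx₀n hxw hx0' with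
      ⟨z, hz⟩ | ⟨z, hz⟩
    · obtain ⟨y, hy⟩ := hlift x z hz
      refine ⟨y, ?_⟩
      have e := congrArg (fun u : (LocalRing L v)ˣ => (u : LocalRing L v)) hy
      simpa only [Units.val_mul, Units.coe_map, MonoidHom.coe_coe] using e
    · -- `x₀·x` would be a norm, forcing `η x₀ = 1`
      have hz' : z * σw z = ((x₀ * x : (LocalRing L v)ˣ) : LocalRing L v) w := by rw [hz, Units.val_mul, Pi.mul_apply]
      obtain ⟨y, hy⟩ := hlift (x₀ * x) z hz'
      have h1 : η (x₀ * x) = 1 := by rw [← hy]; exact hN y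
      rw [map_mul, hηx, mul_one] at h1
      exact absurd h1 hx₀
  · rintro ⟨y, hy⟩
    have hy' : Units.map (conjLocal L (IsCMField.complexConj L) v : LocalRing L v →* LocalRing L v) y * y = x :=
      Units.ext (by rw [Units.val_mul, Units.coe_map, MonoidHom.coe_coe]; exact hy)
    rw [← hy']
    exact hN y

end Summit.HodgeConjecture.HodgeConjecture.R90.S1

end
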